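import Summits.CriticalPhenomena.PercolationContinuityZ3.Theorems.PercNearOneGluingNoHeavyLowerTailPocketCSHPreMarginAvoid
import Summits.CriticalPhenomena.PercolationContinuityZ3.Theorems.SoloBlindKNQuestion7
import HarnessLib

/-!
# KN Question 8 for EVERY relay set, conditional on the pocket hierarchy for Question 8's own pocket family (assembly)

Support file (`--supports stmt-CriticalPhenomena-4575`, closed crux; independent mathematics), prover `prim-ineq-gen-7` (gen 10).
Memo `run/shared/lean/prim/prim-ineq-gen-7/FINDING-Q8-POCKET-g10.md` §3.  No definitions, no named facts, no sorries; standard axioms.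

From `PocketCSH.preMargin_nonneg_of_pcshAvoid` at `D = []` with a second observer `v` that cannot reach `o` (`μ(v↔o) = 0`; the observers'
constant vanishes):
* `PocketCSH.pocketDesignee_of_pcshAvoid` — `∫_{o↔X} F(C c) ≤ ∫_{o↔X} F(C o)` for the pocket designee, every `|X|`, every monotone `F`, for a
  pocket family `𝒟 ∋ {o}` whose pockets miss `X`, given `PCSHHolds` for the pocket-avoiding data only;
* `PocketCSH.kn_question8_block41_of_pcsh` — Question 8's own pockets `𝒟_X = {S | S ∩ X = ∅}` (`{C_o ∈ 𝒟_X} = {o ↮ X}`, the complement of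
  `SoloBlindKN.connTo o X`): for every `X ∌ o`, every `b`, every `c ∈ X` minimising Kozma–Nitzan's score `μ({a↔b} ∖ {o↔X})`:
  `μ({c↔b} ∩ {o↔X}) ≤ μ({o↔b} ∩ {o↔X})` — KN QUESTION 8 (arXiv:2401.12397 §5.5 p. 36) for every `|X|`, conditional on the pocket hierarchy
  for owners / avoided sets / decoys inside `X` (spare vertex `v`, weights `< 1`).
[cite: KozmaNitzan2024, Question 8 (§5.5 p. 36), Conj. 4 (p. 32)] [cite: VandenbergHaggstromKahn2005, Thm. 1.3 (p. 6)]
-/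

noncomputable section

namespace Summit.CriticalPhenomena.PercolationContinuityZ3.Theorems

open MeasureTheory Set Literature.Probability.LatticeModels Literature.Probability.Percolation
open scoped Classical
open KNPreFKG CSH PreFKGSurplus

namespace PocketCSH

variable {n : ℕ}

/-- **(41) for the pocket designee, every relay set, from the pocket hierarchy on pocket-avoiding data** (Conjecture-4 shape).
[cite: KozmaNitzan2024, Question 8 (§5.5 p. 36), Conj. 4 (p. 32)] -/
theorem pocketDesignee_of_pcshAvoid (w : Sym2 (Fin n) → unitInterval) (hw : ∀ e, w e < 1) (o v : Fin n)
    (hvo : (prodBernoulli w).real (openConn v o) = 0)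
    (𝒟 : Set (Set (Fin n))) (h𝒟o : ({o} : Set (Fin n)) ∈ 𝒟)
    (hPCSH : ∀ (x : Fin n) (Y : Finset (Fin n)) (D : List (Fin n)),
      x ∉ Y → o ≠ x → v ≠ x → o ∉ Y → v ∉ Y → D.Nodup → (∀ d ∈ D, d ≠ x ∧ d ∉ Y ∧ d ≠ o ∧ d ≠ v) →
      (∀ S ∈ 𝒟, x ∉ S ∧ (∀ y ∈ Y, y ∉ S) ∧ (∀ d ∈ D, d ∉ S)) →
      PCSHHolds w o 𝒟 x (↑Y : Set (Fin n)) D v)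
    (X : Finset (Fin n)) (c : Fin n) (F : Set (Fin n) → ℝ) (hF : ∀ S S' : Set (Fin n), S ⊆ S' → F S ≤ F S') (hcX : c ∈ X)
    (hcmin : ∀ a ∈ X, ∫ ω in pocketEv o 𝒟, F (openCluster ω c) ∂(prodBernoulli w) ≤ ∫ ω in pocketEv o 𝒟, F (openCluster ω a) ∂(prodBernoulli w))
    (hoX : o ∉ X) (hvX : v ∉ X) (h𝒟X : ∀ S ∈ 𝒟, ∀ a ∈ X, a ∉ S) :
    ∫ ω in ⋃ a ∈ X, openConn o a, F (openCluster ω c) ∂(prodBernoulli w) ≤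
      ∫ ω in ⋃ a ∈ X, openConn o a, F (openCluster ω o) ∂(prodBernoulli w) := by
  classical
  have hint : ∀ (g : BondConfig (Fin n) → ℝ), Integrable g (prodBernoulli w) := fun g => Integrable.of_finite
  have h := preMargin_nonneg_of_pcshAvoid w hw o v 𝒟 h𝒟o hPCSH X c [] F hF hcX hcmin hoX hvX List.nodup_nil (fun d hd => by simp at hd)
    (fun S hS => ⟨fun a ha => h𝒟X S hS a ha, fun d hd => by simp at hd⟩)
  have hp0 : pObsConst w o 𝒟 v ((↑X : Set (Fin n)) ∪ {d | d ∈ ([] : List (Fin n))}) = 0 := by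
    unfold pObsConst
    have hle : (prodBernoulli w).real ({ω : BondConfig (Fin n) | ∀ a ∈ (↑X : Set (Fin n)) ∪ {d | d ∈ ([] : List (Fin n))},
        ¬ (openGraph ω).Reachable v a} ∩ openConn v o) ≤ 0 := by
      rw [← hvo]; exact measureReal_mono (h₂ := measure_ne_top _ _) inter_subset_right
    rw [le_antisymm hle measureReal_nonneg, zero_div]
  rw [pDecoyList_nil, hp0, cshMarg_nil, zero_mul, sub_zero] at h
  simp only [if_true] at h
  rw [integral_sub (hint _).integrableOn (hint _).integrableOn] at h
  linarith

/-- **KOZMA–NITZAN'S QUESTION 8 FOR EVERY RELAY SET, conditional on the pocket hierarchy for Question 8's pockets.**  Weights `< 1`, an observer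
`o ∉ X`, a spare vertex `v ∉ X` with `μ(v↔o) = 0`, and `PCSHHolds w o 𝒟_X x Y D v` for every owner `x ∈ X`, avoided set `Y ⊆ X`, decoys in `X`
(`𝒟_X = {S | S ∩ X = ∅}`).  Then for every `b` and every `c ∈ X` minimising `a ↦ μ({a↔b} ∖ {o↔X})`:  `μ({c↔b} ∩ {o↔X}) ≤ μ({o↔b} ∩ {o↔X})`.
[cite: KozmaNitzan2024, Question 8 (§5.5 p. 36)] -/
theorem kn_question8_block41_of_pcsh (w : Sym2 (Fin n) → unitInterval) (hw : ∀ e, w e < 1) (o v : Fin n)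
    (hvo : (prodBernoulli w).real (openConn v o) = 0) (X : Finset (Fin n)) (hoX : o ∉ X) (hvX : v ∉ X)
    (hPCSH : ∀ (x : Fin n) (Y : Finset (Fin n)) (D : List (Fin n)),
      x ∈ X → Y ⊆ X → (∀ d ∈ D, d ∈ X) →
      x ∉ Y → o ≠ x → v ≠ x → o ∉ Y → v ∉ Y → D.Nodup → (∀ d ∈ D, d ≠ x ∧ d ∉ Y ∧ d ≠ o ∧ d ≠ v) →
      PCSHHolds w o {S : Set (Fin n) | ∀ a ∈ X, a ∉ S} x (↑Y : Set (Fin n)) D v)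
    (c b : Fin n) (hcX : c ∈ X)
    (hcmin : ∀ a ∈ X, (prodBernoulli w).real (openConn c b \ SoloBlindKN.connTo o X) ≤
      (prodBernoulli w).real (openConn a b \ SoloBlindKN.connTo o X)) :
    (prodBernoulli w).real (openConn c b ∩ SoloBlindKN.connTo o X) ≤ (prodBernoulli w).real (openConn o b ∩ SoloBlindKN.connTo o X) := by
  classical
  have hmeas : ∀ S : Set (BondConfig (Fin n)), MeasurableSet S := fun _ => MeasurableSet.of_discrete
  set 𝒟 : Set (Set (Fin n)) := {S : Set (Fin n) | ∀ a ∈ X, a ∉ S} with h𝒟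
  have h𝒟o : ({o} : Set (Fin n)) ∈ 𝒟 := fun a ha hao => hoX (mem_singleton_iff.1 hao ▸ ha)
  -- the pocket event of `𝒟_X` is the complement of `{o ↔ X}`
  have hP : pocketEv o 𝒟 = (SoloBlindKN.connTo o X)ᶜ := by
    ext ω
    simp only [mem_pocketEv, h𝒟, mem_setOf_eq, openCluster, SoloBlindKN.connTo, mem_compl_iff, mem_iUnion, exists_prop, not_exists,
      not_and]
    rfl
  -- the restricted hierarchy hypothesis in the shape of `pocketDesignee_of_pcshAvoid`
  have hPCSH' : ∀ (x : Fin n) (Y : Finset (Fin n)) (D : List (Fin n)),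
      x ∉ Y → o ≠ x → v ≠ x → o ∉ Y → v ∉ Y → D.Nodup → (∀ d ∈ D, d ≠ x ∧ d ∉ Y ∧ d ≠ o ∧ d ≠ v) →
      (∀ S ∈ 𝒟, x ∉ S ∧ (∀ y ∈ Y, y ∉ S) ∧ (∀ d ∈ D, d ∉ S)) → PCSHHolds w o 𝒟 x (↑Y : Set (Fin n)) D v := by
    intro x Y D hxY hox hvx hoY hvY hD hDd hav
    -- a vertex missed by every pocket of `𝒟_X` lies in `X`: test the pocket `{u}`
    have hmemX : ∀ u : Fin n, (∀ S ∈ 𝒟, u ∉ S) → u ∈ X := by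
      intro u hu
      by_contra huX
      have hS : ({u} : Set (Fin n)) ∈ 𝒟 := fun a ha hau => huX (mem_singleton_iff.1 hau ▸ ha)
      exact hu {u} hS (mem_singleton u)
    refine hPCSH x Y D (hmemX x fun S hS => (hav S hS).1) (fun y hy => hmemX y fun S hS => (hav S hS).2.1 y hy)
      (fun d hd => hmemX d fun S hS => (hav S hS).2.2 d hd) hxY hox hvx hoY hvY hD hDd
  set F : Set (Fin n) → ℝ := fun S => if b ∈ S then 1 else 0 with hFdef
  have hF : ∀ S S' : Set (Fin n), S ⊆ S' → F S ≤ F S' := by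
    intro S S' hSS'
    simp only [hFdef]
    by_cases hb : b ∈ S
    · rw [if_pos hb, if_pos (hSS' hb)]
    · rw [if_neg hb]; split_ifs <;> norm_num
  have hind : ∀ (u : Fin n) (E : Set (BondConfig (Fin n))),
      ∫ ω in E, F (openCluster ω u) ∂(prodBernoulli w) = (prodBernoulli w).real (openConn u b ∩ E) := by
    intro u E
    have hfe : (fun ω : BondConfig (Fin n) => F (openCluster ω u)) = (openConn u b : Set (BondConfig (Fin n))).indicator 1 := by
      funext ω
      by_cases hb : (openGraph ω).Reachable u b
      · have h1 : ω ∈ (openConn u b : Set (BondConfig (Fin n))) := hb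
        have h2 : b ∈ openCluster ω u := hb
        rw [indicator_of_mem h1, Pi.one_apply]
        simp only [hFdef, if_pos h2]
      · have h1 : ω ∉ (openConn u b : Set (BondConfig (Fin n))) := hb
        have h2 : b ∉ openCluster ω u := hb
        rw [indicator_of_notMem h1]
        simp only [hFdef, if_neg h2]
    rw [hfe, integral_indicator_one (hmeas _), measureReal_restrict_apply (hmeas _)]
  have hdiff : ∀ u : Fin n, (openConn u b : Set (BondConfig (Fin n))) ∩ (SoloBlindKN.connTo o X)ᶜ = openConn u b \ SoloBlindKN.connTo o X :=
    fun u => Set.ext fun _ => Iff.rfl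
  have key := pocketDesignee_of_pcshAvoid w hw o v hvo 𝒟 h𝒟o hPCSH' X c F hF hcX
    (fun a ha => by rw [hind, hind, hP, hdiff, hdiff]; exact hcmin a ha) hoX hvX (fun S hS a ha => hS a ha)
  rwa [hind, hind] at key

end PocketCSH

end Summit.CriticalPhenomena.PercolationContinuityZ3.Theorems

end
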